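import Literature.MathematicalPhysics.QuantumLattice.SchwartzNuclearExpansionBounds
import Literature.MathematicalPhysics.QuantumFieldTheory.OSSkeletonExplicitBounds
import Summits.QuantumFields.YangMills.Theorems.CurvatureBoostCovariance.Negative.Unbundled
import Summits.QuantumFields.YangMills.Theorems.NPointIsotropy.Negative.HyperoctahedralPlane

/-!
# Slot-product expansion of compactly supported test functions — stub `stub_slotProductExpansion` (T4a)

Line `Sketch` of crux `MirrorModularBoosts.SoftKernelBoostCovariance` (stmt-QuantumFields-14999); pure analysis on `𝓢((ℝ⁴)ⁿ)`.

**Statement.**  Assuming the radial Riemann approximation in `𝓢(ℝ²)` (stub T4b, the first hypothesis: a compactly supported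
planar `a` is close in finitely many seminorms to `∑ᵢ κᵢ G(· - yᵢ)` for ANY normalised radial bump `G = φ(|·|²)` of radius
`ρ ≤ ρ₀(a)`, `yᵢ ∈ supp a`, `∑ |κᵢ| ≤ ‖a‖₁ + 1`): for compactly supported `F ∈ 𝓢((ℝ⁴)ⁿ)` and `δ > 0` there are `A, M` with:
for every finite seminorm set `s`, `η > 0` and all small `ρ`, `F` is `η`-close in `s` to `∑ᵢ λᵢ Tᵢ`,
`Tᵢ(x) = ∏ⱼ φ(|x_j^{pl} - cᵢⱼ|²) hhᵢⱼ(x_j^{tr})`, ONE radial profile `φ` of radius `ρ` with `∫ |φ(|·|²)| ≤ 1`, centres `cᵢⱼ`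
within `δ` of the slot-`j` planar support of `F`, `‖hhᵢⱼ‖₁, ‖hhᵢⱼ‖_∞ ≤ A`, `∑ |λᵢ| ≤ M` (`A, M` independent of `s, η, ρ`).

**Proof.**  (1) In scaled slot coordinates `Λ y (j, μ) = (3/δ) y j μ` (`exists_slotCoordEquiv`) the tree's nuclear expansion of
the identity of `𝓢(E)` (`NuclearExpansion`, `SchwartzNuclearExpansion(Bounds)`) gives `F = ∑_{β ∈ B} η_β F`, a FINITE sum since
`supp F` is compact, over lattice points `β` whose unit box meets `supp F` (`exists_finset_eq_sum_eta`), each piece the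
unconditional sum `∑_k coeff_{β,k}(F) e_{β,k}` (`hasSum_coeff_smul_e`) with `∑_k |coeff_{β,k}(F)| ≤ M₁` (rapid decay,
`exists_sum_norm_coeff_le`); `e_{β,k}` (a product of window × character factors over the `4n` coordinates) is the slot
product `∏ⱼ aⱼ(x_j^{pl}) bⱼ(x_j^{tr})` of compactly supported planar factors `aⱼ ∈ 𝓢(ℝ²)` living within `2` lattice units of
`β`'s slot-`j` planar coordinates and transverse factors with `|bⱼ| ≤ 1`, `‖aⱼ‖₁, ‖bⱼ‖₁ ≤ (4δ/3)²` (`exists_lineFactor`,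
`exists_planeFactor`, `exists_slotFactors`).  (2) Given `s, η`, truncate the `k`-sums to a finite set (error `< η/2`).
(3) The slot product is jointly continuous in the planar factors (`continuous_slotProduct`: the tree's `continuous_tensorFin`,
`tendsto_mulComp`), whence seminorm tolerances for each planar factor (`exists_seminorm_control`); feed them to (T4b), let
`ρ₀` be the least of the finitely many thresholds, and for `ρ ≤ ρ₀` radialise all planar factors with ONE normalised
profile `φ(r) = c · expNegInvGlue(ρ² - r)` (`exists_normalisedRadialBump`).  (4) Multiply out (`Finset.prod_univ_sum`): items
indexed by `Σ_p ∏ⱼ Fin (I p j)`, `λ = coeff · ∏ⱼ κ`, so `∑ |λ| ≤ #B · M₁ · ((4δ/3)² + 1)ⁿ`; the centres `yᵢ ∈ supp aⱼ` are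
within `3` lattice units `= δ` of the slot-`j` planar support of `F` by the locality of `η_β`.
-/

noncomputable section

namespace Summit.QuantumFields.YangMills.Theorems.SoftKernelBoostCovariance.Sketch

open scoped InnerProductSpace SchwartzMap ContDiff
open MeasureTheory Filter Topology Set Literature.MathematicalPhysics.QuantumLattice Literature.MathematicalPhysics.AQFT
  Literature.MathematicalPhysics.QuantumFieldTheory
open Summit.QuantumFields.YangMills.Theorems.NPointIsotropy.Negative (E4)

/-- Scaled linear coordinates on `(ℝ⁴)ⁿ`: `Λ y (j, μ) = σ y j μ` (indexing `Fin (n * 4) ≃ Fin n × Fin 4`). -/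
theorem exists_slotCoordEquiv (n : ℕ) {σ : ℝ} (hσ : σ ≠ 0) : ∃ Λ : (Fin n → E4) ≃L[ℝ] EuclideanSpace ℝ (Fin (n * 4)),
    ∀ y c, Λ y c = σ * y (finProdFinEquiv.symm c).1 (finProdFinEquiv.symm c).2 := by
  let L : (Fin n → E4) ≃ₗ[ℝ] EuclideanSpace ℝ (Fin (n * 4)) :=
    { toFun := fun y => WithLp.toLp 2 fun c => σ * y (finProdFinEquiv.symm c).1 (finProdFinEquiv.symm c).2
      invFun := fun z j => WithLp.toLp 2 fun μ => σ⁻¹ * z (finProdFinEquiv (j, μ))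
      map_add' := fun y y' => by ext c; simp [mul_add]
      map_smul' := fun r y => by ext c; simp [mul_left_comm]
      left_inv := fun y => by ext j μ; simp [hσ]
      right_inv := fun z => by ext c; simp [hσ, -finProdFinEquiv_symm_apply] }
  exact ⟨L.toContinuousLinearEquiv, fun y c => rfl⟩

/-- One-variable window × character factor `θ(t) = w₁(σt - β) e^{2πi k (σt - β + 2)/4}` of the elementary functions, as a
compactly supported Schwartz function: `|θ| ≤ 1`, support in `{|σt - β| ≤ 2}`, `∫|θ| ≤ 4/σ`. -/
theorem exists_lineFactor {σ : ℝ} (hσ : 0 < σ) (β k : ℤ) : ∃ θ : 𝓢(ℝ, ℂ),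
    (∀ t, θ t = (pouWindow 1 (σ * t - β) : ℂ) * Complex.exp ((2 * Real.pi * (k * ((σ * t - β + 2) / 4)) : ℝ) * Complex.I)) ∧
      HasCompactSupport θ ∧ tsupport θ ⊆ {t | |σ * t - β| ≤ 2} ∧ (∀ t, ‖θ t‖ ≤ 1) ∧ Integrable θ ∧ (∫ t, ‖θ t‖) ≤ 4 / σ := by
  set f : ℝ → ℂ := fun t => (pouWindow 1 (σ * t - β) : ℂ) *
    Complex.exp ((2 * Real.pi * (k * ((σ * t - β + 2) / 4)) : ℝ) * Complex.I) with hf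
  have hsm : ContDiff ℝ ∞ f :=
    (contDiff_ofReal_comp ℂ ((contDiff_pouWindow 1).comp (by fun_prop))).mul (Complex.contDiff_exp.comp
      ((contDiff_ofReal_comp ℂ (W := fun t => 2 * Real.pi * (k * ((σ * t - β + 2) / 4))) (by fun_prop)).mul contDiff_const))
  have hzero : ∀ t, 2 ≤ |σ * t - β| → f t = 0 := fun t ht => by
    rw [hf]; simp only
    rw [NuclearExpansion.pouWindow_eq_zero zero_le_one (by linarith), Complex.ofReal_zero, zero_mul]
  have hK : tsupport f ⊆ {t | |σ * t - β| ≤ 2} :=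
    closure_minimal (fun t ht => le_of_not_gt fun h => ht (hzero t h.le)) (isClosed_le (by fun_prop) continuous_const)
  have hKc : {t : ℝ | |σ * t - β| ≤ 2} ⊆ Icc ((β - 2) / σ) ((β + 2) / σ) := fun t (ht : |σ * t - β| ≤ 2) => by
    obtain ⟨h1, h2⟩ := abs_le.1 ht
    exact ⟨by rw [div_le_iff₀ hσ]; linarith, by rw [le_div_iff₀ hσ]; linarith⟩
  have hcs : HasCompactSupport f := IsCompact.of_isClosed_subset isCompact_Icc (isClosed_tsupport f) (hK.trans hKc)
  have hle : ∀ t, ‖f t‖ ≤ 1 := fun t => by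
    have hw : 0 ≤ pouWindow 1 (σ * t - β) ∧ pouWindow 1 (σ * t - β) ≤ 1 := by
      unfold pouWindow
      exact ⟨sub_nonneg.2 (Real.smoothTransition.monotone (by linarith)),
        by linarith [Real.smoothTransition.le_one (σ * t - β + 1 + 1), Real.smoothTransition.nonneg (σ * t - β - 1)]⟩
    rw [hf]; simp only
    rw [norm_mul, Complex.norm_exp_ofReal_mul_I, mul_one, Complex.norm_real, Real.norm_eq_abs, abs_le]
    exact ⟨by linarith [hw.1], hw.2⟩
  refine ⟨hcs.toSchwartzMap hsm, fun t => rfl, hcs, hK, hle, hsm.continuous.integrable_of_hasCompactSupport hcs, ?_⟩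
  have hI : (β - 2) / σ ≤ (β + 2) / σ := div_le_div_of_nonneg_right (by linarith) hσ.le
  calc ∫ t, ‖f t‖ = ∫ t in Icc ((β - 2) / σ) ((β + 2) / σ), ‖f t‖ := (setIntegral_eq_integral_of_forall_compl_eq_zero
        fun t ht => by rw [hzero t (le_of_lt (not_le.1 fun h => ht (hKc h))), norm_zero]).symm
    _ ≤ 1 * volume.real (Icc (((β : ℝ) - 2) / σ) ((β + 2) / σ)) := (Real.le_norm_self _).trans
        (norm_setIntegral_le_of_norm_le_const measure_Icc_lt_top fun t _ => by rw [norm_norm]; exact hle t)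
    _ = 4 / σ := by rw [one_mul, Real.volume_real_Icc_of_le hI]; ring

/-- Product of two one-variable factors as a compactly supported Schwartz function on `ℝ × ℝ`. -/
theorem exists_planeFactor (θ₁ θ₂ : 𝓢(ℝ, ℂ)) (h₁ : HasCompactSupport θ₁) (h₂ : HasCompactSupport θ₂) (hi₁ : Integrable θ₁)
    (hi₂ : Integrable θ₂) (hb₁ : ∀ t, ‖θ₁ t‖ ≤ 1) (hb₂ : ∀ t, ‖θ₂ t‖ ≤ 1) :
    ∃ a : 𝓢(ℝ × ℝ, ℂ), (∀ p, a p = θ₁ p.1 * θ₂ p.2) ∧ HasCompactSupport a ∧ tsupport a ⊆ tsupport θ₁ ×ˢ tsupport θ₂ ∧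
      Integrable a ∧ (∫ p, ‖a p‖) = (∫ t, ‖θ₁ t‖) * ∫ t, ‖θ₂ t‖ ∧ ∀ p, ‖a p‖ ≤ 1 := by
  have hC : ∃ C₀ : ℝ, ∀ x : ℝ × ℝ, ‖x‖ ≤ C₀ * max ‖ContinuousLinearMap.fst ℝ ℝ ℝ x‖ ‖ContinuousLinearMap.snd ℝ ℝ ℝ x‖ :=
    ⟨1, fun x => by simp [Prod.norm_def]⟩
  set a := θ₁.mulComp θ₂ (ContinuousLinearMap.fst ℝ ℝ ℝ) (ContinuousLinearMap.snd ℝ ℝ ℝ) hC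
  have ha : ∀ p, a p = θ₁ p.1 * θ₂ p.2 := fun p => rfl
  have hts : tsupport a ⊆ tsupport θ₁ ×ˢ tsupport θ₂ :=
    closure_minimal (fun p hp => ⟨subset_tsupport _ (mul_ne_zero_iff.1 hp).1, subset_tsupport _ (mul_ne_zero_iff.1 hp).2⟩)
      ((isClosed_tsupport _).prod (isClosed_tsupport _))
  refine ⟨a, ha, .of_isClosed_subset (h₁.prod h₂) (isClosed_tsupport _) hts, hts, hi₁.mul_prod hi₂, ?_, fun p => ?_⟩
  · simp_rw [ha, norm_mul]; exact integral_prod_mul (fun t => ‖θ₁ t‖) (fun t => ‖θ₂ t‖)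
  · rw [ha, norm_mul]; exact mul_le_one₀ (hb₁ _) (norm_nonneg _) (hb₂ _)

/-- Factorisation of the elementary functions `e_{β,k}` of the nuclear expansion, in the scaled slot coordinates, into planar ×
transverse window-character factors, with their supports and uniform `L¹` / `L^∞` bounds. -/
theorem exists_slotFactors (n : ℕ) {σ : ℝ} (hσ : 0 < σ) (Λ : (Fin n → E4) ≃L[ℝ] EuclideanSpace ℝ (Fin (n * 4)))
    (hΛ : ∀ y c, Λ y c = σ * y (finProdFinEquiv.symm c).1 (finProdFinEquiv.symm c).2) (β k : Fin (n * 4) → ℤ) :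
    ∃ a b : Fin n → 𝓢(ℝ × ℝ, ℂ), (∀ y, NuclearExpansion.e Λ β k y = ∏ j, a j (y j 0, y j 1) * b j (y j 2, y j 3)) ∧
      (∀ j, HasCompactSupport (a j)) ∧ (∀ j, tsupport (a j : ℝ × ℝ → ℂ) ⊆
        {p | |σ * p.1 - β (finProdFinEquiv (j, 0))| ≤ 2 ∧ |σ * p.2 - β (finProdFinEquiv (j, 1))| ≤ 2}) ∧
      (∀ j, (∫ p, ‖a j p‖) ≤ (4 / σ) ^ 2) ∧ ∀ j, Integrable (b j) ∧ (∫ p, ‖b j p‖) ≤ (4 / σ) ^ 2 ∧ ∀ p, ‖b j p‖ ≤ 1 := by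
  choose θ hθ hcs hts hle hint hL using fun c : Fin (n * 4) => exists_lineFactor hσ (β c) (k c)
  choose A hA hAcs hAts hAint hAL hAle using fun j (μ ν : Fin 4) => exists_planeFactor (θ (finProdFinEquiv (j, μ)))
    (θ (finProdFinEquiv (j, ν))) (hcs _) (hcs _) (hint _) (hint _) (hle _) (hle _)
  have hL2 : ∀ j μ ν, (∫ p, ‖A j μ ν p‖) ≤ (4 / σ) ^ 2 := fun j μ ν => by
    rw [hAL, sq]; exact mul_le_mul (hL _) (hL _) (integral_nonneg fun _ => norm_nonneg _) (by positivity)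
  refine ⟨fun j => A j 0 1, fun j => A j 2 3, fun y => ?_, fun j => hAcs j 0 1,
    fun j => (hAts j 0 1).trans ((Set.prod_mono (hts _) (hts _)).trans fun p hp => ⟨hp.1, hp.2⟩), fun j => hL2 j 0 1,
    fun j => ⟨hAint j 2 3, hL2 j 2 3, hAle j 2 3⟩⟩
  have hR : ∏ j, A j 0 1 (y j 0, y j 1) * A j 2 3 (y j 2, y j 3) = ∏ c, θ c (y (finProdFinEquiv.symm c).1 (finProdFinEquiv.symm c).2) := by
    rw [← Equiv.prod_comp finProdFinEquiv, Fintype.prod_prod_type]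
    exact Finset.prod_congr rfl fun j _ => by simp only [hA, Fin.prod_univ_four, Equiv.symm_apply_apply, mul_assoc]
  rw [hR, NuclearExpansion.e_apply, NuclearExpansion.winAt_apply]
  simp only [NuclearExpansion.winFun, latticeWindow, NuclearExpansion.coord_sub_latVec]
  simp only [eChar, Real.fourierChar_apply, intForm_apply, NuclearExpansion.cubeCoord_add_cubeShift_apply, hΛ, hθ, Nat.cast_one,
    Complex.ofReal_prod]
  rw [Finset.mul_sum, Complex.ofReal_sum, Finset.sum_mul, Complex.exp_sum, ← Finset.prod_mul_distrib]

/-- A compactly supported test function is a finite sum of its localised pieces `η_β F`, over lattice points `β` whose unit box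
meets its support. -/
theorem exists_finset_eq_sum_eta {E : Type*} [NormedAddCommGroup E] [NormedSpace ℝ E] [FiniteDimensional ℝ E] {m : ℕ}
    (Λ : E ≃L[ℝ] EuclideanSpace ℝ (Fin m)) (F : 𝓢(E, ℂ)) (hF : HasCompactSupport (F : E → ℂ)) :
    ∃ B : Finset (Fin m → ℤ), F = ∑ β ∈ B, NuclearExpansion.eta Λ β F ∧ ∀ β ∈ B, ∃ x ∈ tsupport (F : E → ℂ), ∀ c, |Λ x c - β c| ≤ 1 := by
  classical
  obtain ⟨r, hr⟩ := hF.isCompact.isBounded.exists_norm_le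
  obtain ⟨R, hR⟩ := exists_nat_ge (r * (‖(Λ : E →L[ℝ] EuclideanSpace ℝ (Fin m))‖ + 1))
  refine ⟨(latticeCube m R).filter fun β => NuclearExpansion.eta Λ β F ≠ 0, ?_, fun β hβ => ?_⟩
  · rw [Finset.sum_filter_ne_zero]
    ext y
    have hsum : (∑ β ∈ latticeCube m R, NuclearExpansion.eta Λ β F) y = (latticeWindow Λ R y : ℂ) * F y := by
      rw [← sum_latticeCube_latticeBump, Complex.ofReal_sum, Finset.sum_mul]; simp
    rw [hsum]
    by_cases hy : y ∈ tsupport (F : E → ℂ)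
    · rw [latticeWindow_eq_one Λ ((hr y hy).trans ?_), Complex.ofReal_one, one_mul]
      rwa [le_div_iff₀ (by positivity)]
    · rw [image_eq_zero_of_notMem_tsupport hy, mul_zero]
  · obtain ⟨y, hy⟩ : ∃ y, NuclearExpansion.eta Λ β F y ≠ 0 := by
      by_contra h; push Not at h; exact (Finset.mem_filter.1 hβ).2 (SchwartzMap.ext h)
    refine ⟨y, subset_tsupport _ ?_, fun c => abs_le.2 (NuclearExpansion.tsupport_eta_subset Λ β F (subset_tsupport _ hy) c)⟩
    rw [NuclearExpansion.eta_apply] at hy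
    exact right_ne_zero_of_mul hy

/-- Uniform bound on finite sums of the expansion coefficients of a fixed test function (rapid decay in `k`). -/
theorem exists_sum_norm_coeff_le {E : Type*} [NormedAddCommGroup E] [NormedSpace ℝ E] [FiniteDimensional ℝ E] {m : ℕ}
    (Λ : E ≃L[ℝ] EuclideanSpace ℝ (Fin m)) (F : 𝓢(E, ℂ)) :
    ∃ M₁ : ℝ, ∀ (β : Fin m → ℤ) (K : Finset (Fin m → ℤ)), ∑ k ∈ K, ‖NuclearExpansion.coeff Λ β k F‖ ≤ M₁ := by
  obtain ⟨t, C, hC0, hC⟩ := NuclearExpansion.norm_coeff_mul_pow_le Λ (2 * m)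
  have hw : ∀ k : Fin m → ℤ, 0 < (1 + absSum k) ^ (2 * m) := fun k => pow_pos (by linarith [absSum_nonneg k]) _
  refine ⟨C * schwartzNorm t F * ∑' k : Fin m → ℤ, ((1 + absSum k) ^ (2 * m))⁻¹, fun β K => ?_⟩
  have h0 : 0 ≤ C * schwartzNorm t F := mul_nonneg hC0 (schwartzNorm_nonneg _ _)
  calc ∑ k ∈ K, ‖NuclearExpansion.coeff Λ β k F‖ ≤ ∑ k ∈ K, C * schwartzNorm t F * ((1 + absSum k) ^ (2 * m))⁻¹ := by
        refine Finset.sum_le_sum fun k _ => ?_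
        rw [← div_eq_mul_inv, le_div_iff₀ (hw k)]
        exact (le_mul_of_one_le_right (mul_nonneg (norm_nonneg _) (hw k).le) (one_le_pow₀ (by simp))).trans (hC β k F)
    _ ≤ _ := by
        rw [← Finset.mul_sum]; gcongr
        exact (NuclearExpansion.summable_inv_one_add_absSum_pow (m := m)).sum_le_tsum K fun k _ => (inv_pos.2 (hw k)).le

/-- Seminorm form of continuity at a point of a map of finitely many Schwartz arguments. -/
theorem exists_seminorm_control {ι D V : Type*} [Fintype ι] [NormedAddCommGroup D] [NormedSpace ℝ D] [NormedAddCommGroup V]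
    [NormedSpace ℝ V] {Φ : (ι → 𝓢(V, ℂ)) → 𝓢(D, ℂ)} (hΦ : Continuous Φ) (a : ι → 𝓢(V, ℂ)) (s : Finset (ℕ × ℕ)) {ε : ℝ}
    (hε : 0 < ε) : ∃ (s' : ι → Finset (ℕ × ℕ)) (η' : ι → ℝ), (∀ j, 0 < η' j) ∧ ∀ u : ι → 𝓢(V, ℂ),
      (∀ j, ∀ kl ∈ s' j, SchwartzMap.seminorm ℝ kl.1 kl.2 (a j - u j) < η' j) → (s.sup (schwartzSeminormFamily ℂ D ℂ)) (Φ a - Φ u) < ε := by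
  have hV : Φ ⁻¹' (s.sup (schwartzSeminormFamily ℂ D ℂ)).ball (Φ a) ε ∈ 𝓝 a :=
    hΦ.continuousAt.preimage_mem_nhds (((schwartz_withSeminorms ℂ D ℂ).mem_nhds_iff _ _).2 ⟨s, ε, hε, Subset.rfl⟩)
  rw [nhds_pi, Filter.mem_pi] at hV
  obtain ⟨I, -, t, ht, hsub⟩ := hV
  choose s' η' hη' hball using fun j => ((schwartz_withSeminorms ℝ V ℂ).mem_nhds_iff _ _).1 (ht j)
  refine ⟨s', η', hη', fun u hu => ?_⟩
  have hmem : u ∈ Φ ⁻¹' (s.sup (schwartzSeminormFamily ℂ D ℂ)).ball (Φ a) ε := hsub fun j _ => hball j ((Seminorm.mem_ball _).2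
    (by rw [map_sub_rev]; exact Seminorm.finset_sup_apply_lt (hη' j) fun kl hkl => hu j kl hkl))
  rw [Set.mem_preimage, Seminorm.mem_ball] at hmem
  rwa [map_sub_rev]

/-- Elementary: `c · (η/2)/(c+1) < η/2` for `0 ≤ c`, `0 < η`. -/
theorem mul_half_div_succ_lt {c η : ℝ} (hc : 0 ≤ c) (hη : 0 < η) : c * (η / 2 / (c + 1)) < η / 2 := by
  rw [mul_comm, div_mul_eq_mul_div, div_lt_iff₀ (by linarith)]; nlinarith

/-- Continuity of the slot product `(u_j)_j ↦ ⊗_j (u_j ∘ π₁ · v_j ∘ π₂)` in the first factors. -/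
theorem continuous_slotProduct {D E₁ E₂ : Type*} [NormedAddCommGroup D] [NormedSpace ℝ D] [NormedAddCommGroup E₁]
    [NormedSpace ℝ E₁] [NormedAddCommGroup E₂] [NormedSpace ℝ E₂] (π₁ : D →L[ℝ] E₁) (π₂ : D →L[ℝ] E₂)
    (h : ∃ C₀ : ℝ, ∀ x, ‖x‖ ≤ C₀ * max ‖π₁ x‖ ‖π₂ x‖) (n : ℕ) (v : Fin n → 𝓢(E₂, ℂ)) :
    Continuous fun u : Fin n → 𝓢(E₁, ℂ) => SchwartzMap.tensorFin n fun j => (u j).mulComp (v j) π₁ π₂ h :=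
  (continuous_tensorFin n).comp (continuous_pi fun j => continuous_iff_continuousAt.2 fun u =>
    tendsto_mulComp π₁ π₂ h ((continuous_apply j).tendsto u) tendsto_const_nhds)

/-- A normalised smooth radial bump of radius `ρ` on the plane: `G(p) = φ(|p|²)`, `φ = 0` beyond `ρ²`, `G ≥ 0` real, `∫ G = 1`. -/
theorem exists_normalisedRadialBump {ρ : ℝ} (hρ : 0 < ρ) :
    ∃ (φ : ℝ → ℂ) (G : 𝓢(ℝ × ℝ, ℂ)), (∀ r, ρ ^ 2 < r → φ r = 0) ∧ (∀ p, G p = φ (p.1 ^ 2 + p.2 ^ 2)) ∧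
      (∀ p, 0 ≤ (G p).re ∧ (G p).im = 0) ∧ (∫ p, G p) = 1 ∧
      Integrable (fun p : ℝ × ℝ => φ (p.1 ^ 2 + p.2 ^ 2)) ∧ (∫ p : ℝ × ℝ, ‖φ (p.1 ^ 2 + p.2 ^ 2)‖) ≤ 1 := by
  set g : ℝ × ℝ → ℝ := fun p => expNegInvGlue (ρ ^ 2 - (p.1 ^ 2 + p.2 ^ 2)) with hg
  have hgs : ContDiff ℝ ∞ g := expNegInvGlue.contDiff.comp (by fun_prop)
  have hg0 : ∀ p, ρ < ‖p‖ → g p = 0 := fun p hp => by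
    refine expNegInvGlue.zero_of_nonpos ?_
    rw [Prod.norm_def, Real.norm_eq_abs, Real.norm_eq_abs, lt_max_iff] at hp
    rcases hp with h | h
    · nlinarith [pow_lt_pow_left₀ h hρ.le two_ne_zero, sq_abs p.1, sq_nonneg p.2]
    · nlinarith [pow_lt_pow_left₀ h hρ.le two_ne_zero, sq_abs p.2, sq_nonneg p.1]
  have hgc : HasCompactSupport g := .intro (isCompact_closedBall (0 : ℝ × ℝ) ρ) fun p hp => hg0 p (by simpa using hp)
  have hgi : Integrable g := hgs.continuous.integrable_of_hasCompactSupport hgc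
  have hZ : 0 < ∫ p, g p := by
    refine (integral_pos_iff_support_of_nonneg (fun p => expNegInvGlue.nonneg _) hgi).2
      ((Metric.measure_ball_pos volume (0 : ℝ × ℝ) (half_pos hρ)).trans_le (measure_mono fun p hp => ?_))
    rw [mem_ball_zero_iff, Prod.norm_def, max_lt_iff, Real.norm_eq_abs, Real.norm_eq_abs] at hp
    exact (expNegInvGlue.pos_of_pos (by nlinarith [abs_nonneg p.1, abs_nonneg p.2, sq_abs p.1, sq_abs p.2])).ne'
  have hn : ∀ p, ‖((g p / ∫ p, g p : ℝ) : ℂ)‖ = g p / ∫ p, g p := fun p =>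
    Complex.norm_of_nonneg (div_nonneg (expNegInvGlue.nonneg _) hZ.le)
  refine ⟨fun r => ((expNegInvGlue (ρ ^ 2 - r) / ∫ p, g p : ℝ) : ℂ),
    (hgc.comp_left (g := fun x : ℝ => ((x / ∫ p, g p : ℝ) : ℂ)) (by simp)).toSchwartzMap (Complex.ofRealCLM.contDiff.comp (hgs.div_const _)),
    fun r hr => by simp [expNegInvGlue.zero_of_nonpos (sub_nonpos.2 hr.le)], fun p => rfl,
    fun p => ⟨?_, Complex.ofReal_im _⟩, ?_, (hgi.div_const _).ofReal, ?_⟩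
  · exact (Complex.ofReal_re _).symm ▸ div_nonneg (expNegInvGlue.nonneg _) hZ.le
  · show ∫ p, ((g p / ∫ p, g p : ℝ) : ℂ) = 1
    rw [integral_complex_ofReal, integral_div, div_self hZ.ne', Complex.ofReal_one]
  · show ∫ p, ‖((g p / ∫ p, g p : ℝ) : ℂ)‖ ≤ 1
    simp_rw [hn, integral_div, div_self hZ.ne']; rfl

/-- **Stub (T4a) of line `Sketch`: slot-product expansion with radius-independent coefficient mass.**  For a compactly
supported `F ∈ 𝓢((ℝ⁴)ⁿ)` and `δ > 0` there are `A, M` such that for every finite seminorm set `s`, `η > 0` and all small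
radii `ρ`, `F` is `η`-close to a finite sum `∑ λᵢ Tᵢ` of slot products of ONE radial planar bump of radius `ρ` (centres
within `δ` of the planar slot supports of `F`) with transverse profiles bounded by `A` in `L¹ ∩ L^∞`, and `∑ |λᵢ| ≤ M`;
assuming the radial Riemann approximation in `𝓢(ℝ²)` (first hypothesis, stub T4b).  Proof: module docstring. -/
theorem stub_slotProductExpansion :
    open Literature.MathematicalPhysics.QuantumLattice Literature.MathematicalPhysics.AQFT
      Literature.MathematicalPhysics.QuantumFieldTheory
      Summit.QuantumFields.YangMills.Theorems.CurvatureBoostCovariance.Negative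
      Summit.QuantumFields.YangMills.Theorems.NPointIsotropy.Negative in
    (∀ (a : SchwartzMap (ℝ × ℝ) ℂ), HasCompactSupport (a : ℝ × ℝ → ℂ) →
      ∀ (s : Finset (ℕ × ℕ)) (η : ℝ), 0 < η →
        ∃ ρ₀ : ℝ, 0 < ρ₀ ∧ ∀ ρ : ℝ, 0 < ρ → ρ ≤ ρ₀ →
          ∀ (φ : ℝ → ℂ) (G : SchwartzMap (ℝ × ℝ) ℂ),
            (∀ r : ℝ, ρ ^ 2 < r → φ r = 0) →
            (∀ p : ℝ × ℝ, G p = φ (p.1 ^ 2 + p.2 ^ 2)) →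
            (∀ p : ℝ × ℝ, 0 ≤ (G p).re ∧ (G p).im = 0) →
            (∫ p : ℝ × ℝ, G p) = 1 →
            ∃ (I : ℕ) (y : Fin I → ℝ × ℝ) (κ : Fin I → ℂ) (g : Fin I → SchwartzMap (ℝ × ℝ) ℂ),
              (∀ (i : Fin I) (p : ℝ × ℝ), g i p = φ ((p.1 - (y i).1) ^ 2 + (p.2 - (y i).2) ^ 2)) ∧
              (∀ i : Fin I, y i ∈ tsupport (a : ℝ × ℝ → ℂ)) ∧
              (∑ i, ‖κ i‖ ≤ (∫ p : ℝ × ℝ, ‖a p‖) + 1) ∧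
              (∀ kl ∈ s, SchwartzMap.seminorm ℝ kl.1 kl.2 (a - ∑ i, κ i • g i) < η)) →
    ∀ (n : ℕ) (F : SchwartzMap (Fin n → E4) ℂ), HasCompactSupport (F : (Fin n → E4) → ℂ) →
      ∀ δ : ℝ, 0 < δ →
        ∃ (A M : ℝ), ∀ (s : Finset (ℕ × ℕ)) (η : ℝ), 0 < η →
          ∃ ρ₀ : ℝ, 0 < ρ₀ ∧ ∀ ρ : ℝ, 0 < ρ → ρ ≤ ρ₀ →
            ∃ (φ : ℝ → ℂ) (I : ℕ) (c : Fin I → Fin n → ℝ × ℝ) (hh : Fin I → Fin n → ℝ × ℝ → ℂ)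
              (f0 : Fin I → Fin n → SchwartzMap (Fin 1 → E4) ℂ)
              (lam : Fin I → ℂ) (T : Fin I → SchwartzMap (Fin n → E4) ℂ),
              (∀ r : ℝ, ρ ^ 2 < r → φ r = 0) ∧
              MeasureTheory.Integrable (fun p : ℝ × ℝ => φ (p.1 ^ 2 + p.2 ^ 2)) ∧
              (∫ p : ℝ × ℝ, ‖φ (p.1 ^ 2 + p.2 ^ 2)‖) ≤ 1 ∧
              (∀ (i : Fin I) (j : Fin n) (x : Fin 1 → E4),
                f0 i j x = φ ((x 0 0) ^ 2 + (x 0 1) ^ 2) * hh i j (x 0 2, x 0 3)) ∧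
              (∀ (i : Fin I) (x : Fin n → E4),
                T i x = ∏ j, φ ((x j 0 - (c i j).1) ^ 2 + (x j 1 - (c i j).2) ^ 2) * hh i j (x j 2, x j 3)) ∧
              (∀ (i : Fin I) (j : Fin n), ∃ x ∈ tsupport (F : (Fin n → E4) → ℂ),
                |(c i j).1 - x j 0| ≤ δ ∧ |(c i j).2 - x j 1| ≤ δ) ∧
              (∀ (i : Fin I) (j : Fin n), MeasureTheory.Integrable (hh i j) ∧
                (∫ p : ℝ × ℝ, ‖hh i j p‖) ≤ A ∧ ∀ p : ℝ × ℝ, ‖hh i j p‖ ≤ A) ∧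
              (∑ i, ‖lam i‖ ≤ M) ∧
              (∀ kl ∈ s, SchwartzMap.seminorm ℝ kl.1 kl.2 (F - ∑ i, lam i • T i) < η) := by
  intro hRR n F hF δ hδ
  have hσ : (0 : ℝ) < 3 / δ := by positivity
  obtain ⟨Λ, hΛ⟩ := exists_slotCoordEquiv n hσ.ne'
  obtain ⟨B, hFB, hBloc⟩ := exists_finset_eq_sum_eta Λ F hF
  choose a b hfac hacs hats haL hb using exists_slotFactors n hσ Λ hΛ
  obtain ⟨M₁, hM₁⟩ := exists_sum_norm_coeff_le Λ F
  -- the slot products on `(ℝ⁴)ⁿ`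
  have hC : ∃ C₀ : ℝ, ∀ x : E4, ‖x‖ ≤ C₀ * max ‖((EuclideanSpace.proj 0).prod (EuclideanSpace.proj 1) : E4 →L[ℝ] ℝ × ℝ) x‖
      ‖((EuclideanSpace.proj 2).prod (EuclideanSpace.proj 3) : E4 →L[ℝ] ℝ × ℝ) x‖ :=
    ⟨_, fun x => EuclideanSpace.norm_le_sqrt_card_mul x (by positivity) fun i => by fin_cases i <;> simp [Prod.norm_def]⟩
  obtain ⟨Φ, hΦ, hΦc⟩ : ∃ Φ : (Fin n → 𝓢(ℝ × ℝ, ℂ)) → (Fin n → 𝓢(ℝ × ℝ, ℂ)) → 𝓢((Fin n → E4), ℂ),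
      (∀ u v x, Φ u v x = ∏ j, u j (x j 0, x j 1) * v j (x j 2, x j 3)) ∧ ∀ v, Continuous fun u => Φ u v :=
    ⟨fun u v => SchwartzMap.tensorFin n fun j => (u j).mulComp (v j) _ _ hC, fun u v x => by simp, continuous_slotProduct _ _ hC n⟩
  have hE : ∀ β k, NuclearExpansion.e Λ β k = Φ (a β k) (b β k) := fun β k => by ext y; rw [hfac, hΦ]
  set A₀ : ℝ := (4 / (3 / δ)) ^ 2
  refine ⟨max A₀ 1, B.card * M₁ * (A₀ + 1) ^ n, fun s η hη => ?_⟩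
  set q : Seminorm ℂ 𝓢((Fin n → E4), ℂ) := s.sup (schwartzSeminormFamily ℂ (Fin n → E4) ℂ)
  -- (2) truncation of the box Fourier series of the finitely many localised pieces
  obtain ⟨K, hK⟩ : ∃ K : Finset (Fin (n * 4) → ℤ),
      q (F - ∑ p ∈ B ×ˢ K, NuclearExpansion.coeff Λ p.1 p.2 F • NuclearExpansion.e Λ p.1 p.2) < η / 2 := by
    have h := tendsto_finsetSum B fun β _ => NuclearExpansion.hasSum_coeff_smul_e Λ β F
    rw [← hFB, (schwartz_withSeminorms ℂ (Fin n → E4) ℂ).tendsto_nhds'] at h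
    obtain ⟨K, hK⟩ := Filter.eventually_atTop.1 (by simpa only [SummationFilter.unconditional_filter] using h s _ (half_pos hη))
    exact ⟨K, by rw [map_sub_rev, Finset.sum_product]; exact hK K le_rfl⟩
  set P : Finset ((Fin (n * 4) → ℤ) × (Fin (n * 4) → ℤ)) := B ×ˢ K
  -- (3) tolerances for the radialisation of the planar factors, thresholds of (T4b), the common profile
  set Ct : ℝ := ∑ p ∈ P, ‖NuclearExpansion.coeff Λ p.1 p.2 F‖
  have hCt0 : 0 ≤ Ct := Finset.sum_nonneg fun _ _ => norm_nonneg _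
  have hε : 0 < η / 2 / (Ct + 1) := div_pos (half_pos hη) (by linarith)
  choose s' η' hη' hclose using fun p : (Fin (n * 4) → ℤ) × (Fin (n * 4) → ℤ) =>
    exists_seminorm_control (hΦc (b p.1 p.2)) (a p.1 p.2) s hε
  choose ρf hρf hitems using fun (p : (Fin (n * 4) → ℤ) × (Fin (n * 4) → ℤ)) (j : Fin n) =>
    hRR (a p.1 p.2 j) (hacs p.1 p.2 j) (s' p j) (η' p j) (hη' p j)
  obtain ⟨ρ₀, hρ₀, hρ₀le⟩ : ∃ ρ₀ : ℝ, 0 < ρ₀ ∧ ∀ p ∈ P, ∀ j, ρ₀ ≤ ρf p j := by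
    refine ⟨(insert 1 ((P ×ˢ Finset.univ).image fun pj => ρf pj.1 pj.2)).min' (Finset.insert_nonempty _ _),
      (Finset.lt_min'_iff _ _).2 fun r hr => ?_, fun p hp j => Finset.min'_le _ _ ?_⟩
    · rcases Finset.mem_insert.1 hr with rfl | hr
      · exact one_pos
      · obtain ⟨pj, -, rfl⟩ := Finset.mem_image.1 hr; exact hρf _ _
    · exact Finset.mem_insert_of_mem (Finset.mem_image.2 ⟨(p, j), Finset.mem_product.2 ⟨hp, Finset.mem_univ j⟩, rfl⟩)
  refine ⟨ρ₀, hρ₀, fun ρ hρ hρS => ?_⟩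
  obtain ⟨φ, G, hφ0, hGφ, hGre, hG1, hφi, hφL⟩ := exists_normalisedRadialBump hρ
  choose I y κ g hg hy hκ happ using fun (p : ↥P) (j : Fin n) =>
    hitems p.1 j ρ hρ (hρS.trans (hρ₀le p.1 p.2 j)) φ G hφ0 hGφ hGre hG1
  -- (4) the items, indexed by `Σ_{p ∈ P} ∏ⱼ Fin (I p j)`
  obtain ⟨N, ⟨ev⟩⟩ : ∃ N, Nonempty (Fin N ≃ Σ p : ↥P, ((j : Fin n) → Fin (I p j))) := ⟨_, ⟨(Fintype.equivFin _).symm⟩⟩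
  refine ⟨φ, N, fun i j => y (ev i).1 j ((ev i).2 j), fun i j => ⇑(b (ev i).1.1.1 (ev i).1.1.2 j),
    fun i j => SchwartzMap.tensorFin 1 fun _ => G.mulComp (b (ev i).1.1.1 (ev i).1.1.2 j) _ _ hC,
    fun i => NuclearExpansion.coeff Λ (ev i).1.1.1 (ev i).1.1.2 F * ∏ j, κ (ev i).1 j ((ev i).2 j),
    fun i => Φ (fun j => g (ev i).1 j ((ev i).2 j)) (b (ev i).1.1.1 (ev i).1.1.2), hφ0, hφi, hφL,
    fun i j x => by simp [hGφ], fun i x => by simp only [hΦ, hg], fun i j => ?_, fun i j => ?_, ?_, fun kl hkl => ?_⟩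
  · -- centres: `y ∈ supp a_{p,j}` is within `3` lattice units of the slot-`j` planar support of `F`
    obtain ⟨x, hx, hxβ⟩ := hBloc _ (Finset.mem_product.1 (ev i).1.2).1
    have hy' := hats _ _ j (hy (ev i).1 j ((ev i).2 j))
    have key : ∀ u v w : ℝ, |3 / δ * u - w| ≤ 2 → |3 / δ * v - w| ≤ 1 → |u - v| ≤ δ := fun u v w h1 h2 => by
      have h3 : |3 / δ * u - w - (3 / δ * v - w)| ≤ 3 := (abs_sub _ _).trans (by linarith)
      rw [show 3 / δ * u - w - (3 / δ * v - w) = 3 / δ * (u - v) by ring, abs_mul, abs_of_pos hσ] at h3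
      exact le_of_mul_le_mul_left (h3.trans_eq (div_mul_cancel₀ (3 : ℝ) hδ.ne').symm) hσ
    have h0 := hxβ (finProdFinEquiv (j, 0)); have h1 := hxβ (finProdFinEquiv (j, 1))
    rw [hΛ, Equiv.symm_apply_apply] at h0 h1
    exact ⟨x, hx, key _ _ _ hy'.1 h0, key _ _ _ hy'.2 h1⟩
  · exact ⟨(hb _ _ j).1, (hb _ _ j).2.1.trans (le_max_left _ _), fun p => ((hb _ _ j).2.2 p).trans (le_max_right _ _)⟩
  · -- coefficient mass
    have hP1 : ∑ p ∈ P, ‖NuclearExpansion.coeff Λ p.1 p.2 F‖ ≤ B.card * M₁ := by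
      rw [Finset.sum_product]
      exact (Finset.sum_le_sum fun β _ => hM₁ β _).trans (by rw [Finset.sum_const, nsmul_eq_mul])
    have hpr : ∀ p : ↥P, ∑ ι : (j : Fin n) → Fin (I p j), ∏ j, ‖κ p j (ι j)‖ ≤ (A₀ + 1) ^ n := fun p => by
      rw [← Fintype.piFinset_univ, ← Finset.prod_univ_sum (fun _ => Finset.univ) fun j i => ‖κ p j i‖]
      exact (Finset.prod_le_prod (fun j _ => by positivity) fun j _ => show ∑ i, ‖κ p j i‖ ≤ A₀ + 1 from
        (hκ p j).trans (by linarith [haL p.1.1 p.1.2 j])).trans (by rw [Finset.prod_const, Finset.card_univ, Fintype.card_fin])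
    beta_reduce
    rw [Equiv.sum_comp ev fun w => ‖NuclearExpansion.coeff Λ w.1.1.1 w.1.1.2 F * ∏ j, κ w.1 j (w.2 j)‖, Fintype.sum_sigma]
    simp_rw [norm_mul, norm_prod, ← Finset.mul_sum]
    calc ∑ p : ↥P, ‖NuclearExpansion.coeff Λ p.1.1 p.1.2 F‖ * ∑ ι : (j : Fin n) → Fin (I p j), ∏ j, ‖κ p j (ι j)‖
        ≤ ∑ p : ↥P, ‖NuclearExpansion.coeff Λ p.1.1 p.1.2 F‖ * (A₀ + 1) ^ n :=
          Finset.sum_le_sum fun p _ => mul_le_mul_of_nonneg_left (hpr p) (norm_nonneg _)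
      _ = (∑ p ∈ P, ‖NuclearExpansion.coeff Λ p.1 p.2 F‖) * (A₀ + 1) ^ n := by
          rw [← Finset.sum_mul, Finset.sum_coe_sort P fun p => ‖NuclearExpansion.coeff Λ p.1 p.2 F‖]
      _ ≤ B.card * M₁ * (A₀ + 1) ^ n := by gcongr
  · -- approximation
    refine (Seminorm.le_finset_sup_apply (p := schwartzSeminormFamily ℂ (Fin n → E4) ℂ) hkl).trans_lt ?_
    have hsum : ∑ i, (NuclearExpansion.coeff Λ (ev i).1.1.1 (ev i).1.1.2 F * ∏ j, κ (ev i).1 j ((ev i).2 j)) •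
        Φ (fun j => g (ev i).1 j ((ev i).2 j)) (b (ev i).1.1.1 (ev i).1.1.2) =
        ∑ p : ↥P, NuclearExpansion.coeff Λ p.1.1 p.1.2 F • Φ (fun j => ∑ i, κ p j i • g p j i) (b p.1.1 p.1.2) := by
      rw [Equiv.sum_comp ev fun w => (NuclearExpansion.coeff Λ w.1.1.1 w.1.1.2 F * ∏ j, κ w.1 j (w.2 j)) •
        Φ (fun j => g w.1 j (w.2 j)) (b w.1.1.1 w.1.1.2), Fintype.sum_sigma]
      refine Finset.sum_congr rfl fun p _ => ?_
      simp_rw [mul_smul, ← Finset.smul_sum]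
      congr 1; ext x
      simp only [hΦ, sum_apply, smul_apply, smul_eq_mul, Finset.sum_mul]
      rw [Finset.prod_univ_sum]
      simp only [Fintype.piFinset_univ, mul_assoc, Finset.prod_mul_distrib]
    have h2 : q (∑ p : ↥P, NuclearExpansion.coeff Λ p.1.1 p.1.2 F •
        (Φ (a p.1.1 p.1.2) (b p.1.1 p.1.2) - Φ (fun j => ∑ i, κ p j i • g p j i) (b p.1.1 p.1.2))) ≤ η / 2 := by
      refine (Finset.le_sum_of_subadditive q (map_zero q).le (map_add_le_add q) _ _).trans ?_
      calc _ ≤ ∑ p : ↥P, ‖NuclearExpansion.coeff Λ p.1.1 p.1.2 F‖ * (η / 2 / (Ct + 1)) := Finset.sum_le_sum fun p _ => by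
              rw [map_smul_eq_mul]
              exact mul_le_mul_of_nonneg_left (hclose _ _ fun j kl hkl => happ p j kl hkl).le (norm_nonneg _)
        _ = Ct * (η / 2 / (Ct + 1)) := by rw [← Finset.sum_mul, Finset.sum_coe_sort P fun p => ‖NuclearExpansion.coeff Λ p.1 p.2 F‖]
        _ ≤ η / 2 := (mul_half_div_succ_lt hCt0 hη).le
    calc q (F - ∑ i, (NuclearExpansion.coeff Λ (ev i).1.1.1 (ev i).1.1.2 F * ∏ j, κ (ev i).1 j ((ev i).2 j)) •
          Φ (fun j => g (ev i).1 j ((ev i).2 j)) (b (ev i).1.1.1 (ev i).1.1.2))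
        = q ((F - ∑ p ∈ P, NuclearExpansion.coeff Λ p.1 p.2 F • NuclearExpansion.e Λ p.1 p.2) + ∑ p : ↥P,
            NuclearExpansion.coeff Λ p.1.1 p.1.2 F • (Φ (a p.1.1 p.1.2) (b p.1.1 p.1.2) - Φ (fun j => ∑ i, κ p j i • g p j i) (b p.1.1 p.1.2))) := by
          rw [hsum, ← Finset.sum_coe_sort P]
          simp_rw [hE, smul_sub, Finset.sum_sub_distrib]
          abel_nf
      _ ≤ _ := map_add_le_add q _ _
      _ < η / 2 + η / 2 := add_lt_add_of_lt_of_le hK h2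
      _ = η := by ring

end Summit.QuantumFields.YangMills.Theorems.SoftKernelBoostCovariance.Sketch
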